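import Summits.KontsevichZagierPeriods.KontsevichZagierPeriods.Theorems.HurwitzMicroSectorsNormalFormPrincipleDlogMoves
import Summits.KontsevichZagierPeriods.KontsevichZagierPeriods.Theorems.AbelContractionRealHyperellipticSectorBudgetKit

/-!
# Route AbelContraction — `RealHyperellipticSector` (crux stmt-KontsevichZagierPeriods-12475):
# the dimension-certified port, layer 1 — the dlog representations and their moves

Helper file of the line `Lines/birth.lean` (stub `stub_bakerAlg`, `--supports` the crux): the port
of `Theorems/HurwitzMicroSectorsNormalFormPrincipleDlogMoves.lean` (namespace
`…NormalFormPrinciple.PiBox.Dlog`) INTO THE BUDGET `KZ.relationsLE 1` — every statement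
`… ∈ relations` of that file re-proved with the conclusion `… ∈ relationsLE 1`, each base move
carrying the certificate that all its representations have dimension `1` (rules 1a, 1b, 2), via
the budget kit `…RealHyperellipticSectorBudgetKit.lean` and `AbelContractionAbelContractionLemma.lean`:

* congruence / zero integrand / empty slab (rule 1: `dlog_congr_mem_relationsLE`,
  `dlog_zero_mem_relationsLE`, `slab_empty_mem_relationsLE`);
* **merging** (rule 1b) `[σ, (c+c')/y] ≡ [σ, c/y] + [σ, c'/y]` (`dlog_merge_mem_relationsLE`);
* **splitting** (rule 1a and a null point) `[(a,b'), f] ≡ [(a,b), f] + [(b,b'), f]`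
  (`split_mem_relationsLE`);
* **scaling** (rule 2, the dilation `y ↦ s y`) `[(a,b), c/y] ≡ [(sa,sb), c/y]`
  (`dlog_scale_mem_relationsLE`, registered sub-goal).

The dimension-free lemmas of the original (`volume_slab`, `volume_slab_singleton`, `exists_dlog`,
`value_dlog`, `image_smul_slab`) are reused by importing it; names and hypotheses are those of the
original with `relations ↦ relationsLE`.

Sources: M. Kontsevich, D. Zagier, *Periods* (2001), §1.1 (`log 2 = ∫₁² dx/x`), §1.2 rules (1), (2)
[KontsevichZagier2001]. No definitions are introduced.
-/

noncomputable section

open MeasureTheory Set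
open Literature.NumberTheory.Transcendental Literature.NumberTheory.Transcendental.KZ
open Literature.ModelTheory.ExponentialFields (IsSemialgebraic)
open Summit.KontsevichZagierPeriods.AbelContraction.AbelContractionLemma
  (mem_relationsLE_of_integrandAdd of_mem_relationsLE_of_eqOn_zero)

namespace Summit.KontsevichZagierPeriods.AbelContraction.RealHyperellipticSector.Port

namespace Dlog

open Summit.KontsevichZagierPeriods.KontsevichZagierPeriods.BetaCancellationLine
  (aff_hasFDerivAt_chart aff_abs_det_chartDeriv aff_injective_chart aff_isSemialgebraicMapOn_chart)
open Summit.KontsevichZagierPeriods.HurwitzMicroSectors.NormalFormPrinciple.PiBox.Dlog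
  (volume_slab_singleton image_smul_slab)

/-! ## The moves inside the budget -/

/-- **Congruence**: two representations on the same slab with integrands `c/y` differ by a
truncated relation (inside the budget `relationsLE 1`). [cite: KontsevichZagier2001, §1.2 rule (1)] -/
theorem dlog_congr_mem_relationsLE {σ : Set (Fin 1 → ℝ)} {c : ℚ} (L L' : IntegralRep 1)
    (hd : L.domain = σ) (hd' : L'.domain = σ)
    (hi : EqOn L.integrand (fun x => (c:ℝ) / x 0) L.domain)
    (hi' : EqOn L'.integrand (fun x => (c:ℝ) / x 0) L'.domain) :
    of L - of L' ∈ relationsLE 1 :=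
  Budget.congr_mem_relationsLE le_rfl (hd'.trans hd.symm) fun x hx => by
    rw [hi hx, hi' (by rw [hd', ← hd]; exact hx)]

/-- **Zero integrand**: `[(a,b), 0/y] ∈ relationsLE 1` (inside the budget `relationsLE 1`).
[cite: KontsevichZagier2001, §1.2 rule (1)] -/
theorem dlog_zero_mem_relationsLE (L : IntegralRep 1)
    (hi : EqOn L.integrand (fun x => ((0:ℚ):ℝ) / x 0) L.domain) : of L ∈ relationsLE 1 :=
  of_mem_relationsLE_of_eqOn_zero le_rfl L fun x hx => by simp [hi hx]

/-- **Empty slab**: a representation on `{a < y < b}` with `b ≤ a` is a truncated relation (null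
domain) (inside the budget `relationsLE 1`). [cite: KontsevichZagier2001, §1.2 rule (1)] -/
theorem slab_empty_mem_relationsLE {a b : ℝ} (L : IntegralRep 1)
    (hd : L.domain = {x | x 0 ∈ Set.Ioo a b}) (hba : b ≤ a) : of L ∈ relationsLE 1 := by
  refine Budget.of_mem_relationsLE_of_volume_eq_zero le_rfl L ?_
  rw [hd, Set.Ioo_eq_empty (not_lt.mpr hba)]
  simp

/-- **Merging** (rule 1b): `[(σ), (c+c')/y] − [σ, c/y] − [σ, c'/y] ∈ relationsLE 1`
(inside the budget `relationsLE 1`). [cite: KontsevichZagier2001, §1.2 rule (1)] -/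
theorem dlog_merge_mem_relationsLE {σ : Set (Fin 1 → ℝ)} {c c' : ℚ} (L L₁ L₂ : IntegralRep 1)
    (hd : L.domain = σ) (hd₁ : L₁.domain = σ) (hd₂ : L₂.domain = σ)
    (hi : EqOn L.integrand (fun x => ((c + c' : ℚ):ℝ) / x 0) L.domain)
    (hi₁ : EqOn L₁.integrand (fun x => (c:ℝ) / x 0) L₁.domain)
    (hi₂ : EqOn L₂.integrand (fun x => (c':ℝ) / x 0) L₂.domain) :
    of L - of L₁ - of L₂ ∈ relationsLE 1 := by
  refine mem_relationsLE_of_integrandAdd le_rfl (hd₁.trans hd.symm) (hd₂.trans hd.symm)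
    fun x hx => ?_
  rw [Pi.add_apply, hi hx, hi₁ (by rw [hd₁, ← hd]; exact hx), hi₂ (by rw [hd₂, ← hd]; exact hx)]
  push_cast
  ring

/-- **Splitting** (rule 1a among representations of dimension `1`, plus a null point)
(inside the budget `relationsLE 1`, port of `PiBox.Dlog.split_mem_relations`): for `a ≤ b ≤ b'`
and one integrand `f`,
`[(a,b'), f] − [(a,b), f] − [(b,b'), f] ∈ relationsLE 1`. [cite: KontsevichZagier2001, §1.2 rule (1)] -/
theorem split_mem_relationsLE {a b b' : ℝ} (L L₁ L₂ : IntegralRep 1)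
    (hd : L.domain = {x | x 0 ∈ Set.Ioo a b'}) (hd₁ : L₁.domain = {x | x 0 ∈ Set.Ioo a b})
    (hd₂ : L₂.domain = {x | x 0 ∈ Set.Ioo b b'}) (hab : a ≤ b) (hbb' : b ≤ b')
    (hi₁ : EqOn L₁.integrand L.integrand L₁.domain) (hi₂ : EqOn L₂.integrand L.integrand L₂.domain) :
    of L - of L₁ - of L₂ ∈ relationsLE 1 := by
  -- remove the point `b`
  set E : Set (Fin 1 → ℝ) := {x | x 0 ∈ Set.Ioo a b} ∪ {x | x 0 ∈ Set.Ioo b b'} with hE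
  have hEsa : IsSemialgebraic ℚ E := by
    have := L₁.isSemialgebraic_domain.union L₂.isSemialgebraic_domain
    rwa [hd₁, hd₂] at this
  have hEsub : E ⊆ L.domain := by
    rw [hd]
    rintro x (hx | hx)
    · exact ⟨hx.1, lt_of_lt_of_le hx.2 hbb'⟩
    · exact ⟨lt_of_le_of_lt hab hx.1, hx.2⟩
  have hnull : volume (L.domain \ E) = 0 := by
    refine measure_mono_null (fun x hx => ?_) (volume_slab_singleton b)
    rw [hd] at hx
    obtain ⟨⟨h1, h2⟩, hx'⟩ := hx
    simp only [hE, Set.mem_union, Set.mem_setOf_eq, Set.mem_Ioo, not_or, not_and, not_lt] at hx'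
    obtain ⟨h3, h4⟩ := hx'
    show x 0 ∈ ({b} : Set ℝ)
    have hb1 : b ≤ x 0 := h3 h1
    have hb2 : x 0 ≤ b := by
      by_contra hlt
      exact absurd (h4 (not_le.mp hlt)) (not_le.mpr h2)
    exact le_antisymm hb2 hb1
  have h0 : of L - of (L.restrict E hEsa hEsub) ∈ relationsLE 1 :=
    Budget.of_sub_of_restrict_mem_relationsLE le_rfl L hEsa hEsub hnull
  -- domain additivity on `E = (a,b) ∪ (b,b')`, among representations of dimension `1`
  have h1 : of (L.restrict E hEsa hEsub) - of L₁ - of L₂ ∈ relationsLE 1 := by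
    refine Budget.domainAdd_mem_relationsLE le_rfl ?_ ?_
      (fun x hx => (hi₁ hx).symm) fun x hx => (hi₂ hx).symm
    · rw [IntegralRep.domain_restrict, hd₁, hd₂]
    · rw [hd₁, hd₂]
      have : {x : Fin 1 → ℝ | x 0 ∈ Set.Ioo a b} ∩ {x | x 0 ∈ Set.Ioo b b'} = ∅ := by
        ext x
        simp only [Set.mem_inter_iff, Set.mem_setOf_eq, Set.mem_Ioo, Set.mem_empty_iff_false,
          iff_false, not_and, not_lt]
        intro h h'
        exact absurd (h.2.trans h') (lt_irrefl _)
      rw [this, measure_empty]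
  have : of L - of L₁ - of L₂ = (of L - of (L.restrict E hEsa hEsub)) +
      (of (L.restrict E hEsa hEsub) - of L₁ - of L₂) := by abel
  rw [this]
  exact (relationsLE 1).add_mem h0 h1

/-- **Scaling** (rule 2 among representations of dimension `1`) (inside the budget
`relationsLE 1`; registered sub-goal of crux stmt-KontsevichZagierPeriods-12475, port of
`PiBox.Dlog.dlog_scale_mem_relations`): for rational `s > 0` and `0 < a`,
`[(a,b), c/y] − [(sa, sb), c/y] ∈ relationsLE 1` — the dilation `y ↦ s·y` has Jacobian `s` and
`c/y = (c/(s y))·s`.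
[cite: KontsevichZagier2001, §1.2 rule (2)] -/
theorem dlog_scale_mem_relationsLE : ∀ {a b c s : ℚ} (L L' : KZ.IntegralRep 1),
    L.domain = {x | x 0 ∈ Set.Ioo (a:ℝ) b} →
    L'.domain = {x | x 0 ∈ Set.Ioo ((s * a : ℚ):ℝ) ((s * b : ℚ):ℝ)} →
    Set.EqOn L.integrand (fun x => (c:ℝ) / x 0) L.domain →
    Set.EqOn L'.integrand (fun x => (c:ℝ) / x 0) L'.domain → 0 < a → 0 < s →
    KZ.of L - KZ.of L' ∈ KZ.relationsLE 1 := by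
  intro a b c s L L' hd hd' hi hi' ha hs
  have hs' : (0:ℝ) < s := by exact_mod_cast hs
  have himage : L'.domain = (fun y : Fin 1 → ℝ => fun _ : Fin 1 => (s:ℝ) * y 0 + 0) '' L.domain := by
    rw [hd, image_smul_slab hs', hd']
    push_cast
    rfl
  refine Budget.changeOfVariables_mem_relationsLE le_rfl
    (fun y : Fin 1 → ℝ => fun _ : Fin 1 => (s:ℝ) * y 0 + 0)
    (fun _ => (s:ℝ) • ContinuousLinearMap.id ℝ (Fin 1 → ℝ))
    (aff_isSemialgebraicMapOn_chart L.isSemialgebraic_domain isAlgebraic_zero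
      (isAlgebraic_algebraMap s))
    (fun x _ => (aff_hasFDerivAt_chart (s:ℝ) 0 x).hasFDerivWithinAt)
    (aff_injective_chart hs'.ne' 0).injOn himage fun x hx => ?_
  have hΦx : (fun _ : Fin 1 => (s:ℝ) * x 0 + 0) ∈ L'.domain := himage ▸ Set.mem_image_of_mem _ hx
  have hx0 : (0:ℝ) < x 0 := by
    rw [hd] at hx
    exact lt_trans (by exact_mod_cast ha) hx.1
  rw [hi hx, hi' hΦx, aff_abs_det_chartDeriv hs']
  simp only [add_zero]
  field_simp

end Dlog

end Summit.KontsevichZagierPeriods.AbelContraction.RealHyperellipticSector.Port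

end
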